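import Mathlib
import HarnessLib
import Summits.PneNP.PneNP.Theorems.CnfIdealGenLengthRankDefectRepresentationsCutLemma
import Summits.PneNP.PneNP.Theorems.CnfIdealGenLengthRankDefectRepresentationsExactification
import Summits.PneNP.PneNP.Theorems.CnfIdealGenLengthRankDefectRepresentationsMergeLowerBound
import Literature.Algebra.Module.EndomorphismRingLocalIdempotents
import Literature.LinearAlgebra.Matrix.JordanCanonicalFormUniqueness

/-!
# Absolute merge for a pair: one idempotent against an exact cell system (registered stub `stub_absoluteMergePair`,
crux `RankDefectRepresentations` = stmt-PneNP-18923, line `cell-union-merge`, brief g17 §W26)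

THEOREM (`stub_absoluteMergePair`, constant `16`; the proof gives `12`).  Let `E` be an idempotent `d × d` matrix and
`Q : Y → Mat_d(K)` a complete system of orthogonal idempotents (`Q_y² = Q_y`, `Q_y Q_{y'} = 0`, `∑ Q_y = 1`).  If every
union `Q_B = ∑_{y ∈ B} Q_y` almost commutes with `E`, `rank [E, Q_B] ≤ c`, then `E` is within rank `16 c` of an idempotent
`E'` commuting with every `Q_y`.

Proof.
* ADAPTED BASIS (`stub_absoluteMergePair`): the endomorphisms `q_y = toLin' Q_y` are complete orthogonal idempotents, so
  `K^d = ⊕_y im q_y` (`Literature…isInternal_range_of_completeOrthogonalIdempotents`); in the collected basis `b`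
  (index type `Σ y, Fin (n y)`) the algebra isomorphism `Φ = toMatrixAlgEquiv b ∘ toLinAlgEquiv'` preserves ranks and sends
  `Q_y` to the diagonal `0/1` matrix of the colour class `y`.
* CUTS FROM COMMUTATORS (`cut_add_cut_le_rank_comm`): for a colouring of the indices and the diagonal indicator `D_B` of a set
  of colours, the two off-diagonal colour blocks of `F` have total rank `≤ rank (F D_B − D_B F)` (they sit in a block
  triangular pattern of the commutator: `…CutLemmaMonotoneCuts.rank_blocks_le_of_lowerLeft_zero`).
* MAX-CUT DECOMPOSITION (`exists_colourDiagonal_near`): `…CutLemma.exists_blockDiagonal_of_maxCut` puts `F` within rank `4c`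
  of a colour-block-diagonal `F₁`.
* BLOCKWISE CHEAP FITTING (`exists_blockIdempotent_near`): `F₁ = blockDiagonal' G`; each block `G_y` is within
  `rank (G_y² − G_y)` of an idempotent (`…Exactification.exists_idempotent_near`), ranks of block-diagonal matrices add
  (`Literature…rank_blockDiagonal'`), and `rank (F₁² − F₁) ≤ 2 rank (F − F₁)` (`rank_sq_sub_self_le`); total `4c + 8c = 12c`.
HONEST FRAMING: this is the `|X| = 2` shadow of the lead stub `stub_absoluteMerge` of line `cell-union-merge`; elementary
linear algebra; the item-deciding statements remain open; P ≠ NP is not moved; F-N2 is a FRONTIER formal rung.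
-/

set_option linter.dupNamespace false -- `Summit.PneNP.PneNP.…`: summit = sub-problem name (D-0017)

namespace Summit.PneNP.PneNP.Theorems.CnfIdealGenLengthRankDefectRepresentationsAbsoluteMergePair

open Finset Matrix Module
open Summit.PneNP.PneNP.Theorems.CnfIdealGenLengthRankDefectRepresentationsCutLemma
  (exists_blockDiagonal_of_maxCut rank_padBlock_eq)
open Summit.PneNP.PneNP.Theorems.CnfIdealGenLengthRankDefectRepresentationsCutLemmaMonotoneCuts
  (rank_blocks_le_of_lowerLeft_zero)
open Summit.PneNP.PneNP.Theorems.CnfIdealGenLengthRankDefectRepresentationsMergeLowerBound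
  (rank_add_le' rank_sub_le' rank_neg')
open Summit.PneNP.PneNP.Theorems.CnfIdealGenLength (exists_idempotent_near)
open Literature.Algebra.Module.KrullSchmidt
  (isInternal_range_of_completeOrthogonalIdempotents range_le_ker_of_orthogonalIdempotents)

variable {K : Type} [Field K]

section Cuts

variable {σ Y : Type} [Fintype σ] [DecidableEq σ] [DecidableEq Y]

/-- **Cuts from commutators.**  For a colouring `colour` of the indices and the diagonal indicator `D_B` of a set `B` of
colours, the two off-diagonal colour blocks `F ∘ 1[(colour ∈ B) × (colour ∉ B)]` and `F ∘ 1[(colour ∉ B) × (colour ∈ B)]`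
have total rank at most `rank (F D_B − D_B F)`. [folklore] -/
theorem cut_add_cut_le_rank_comm (colour : σ → Y) (F : Matrix σ σ K) (B : Finset Y) :
    (Matrix.of fun i j => if colour i ∈ B ∧ colour j ∉ B then F i j else 0).rank +
      (Matrix.of fun i j => if colour i ∉ B ∧ colour j ∈ B then F i j else 0).rank ≤
    (F * Matrix.diagonal (fun i => if colour i ∈ B then (1 : K) else 0) -
      Matrix.diagonal (fun i => if colour i ∈ B then (1 : K) else 0) * F).rank := by
  classical
  set M := F * Matrix.diagonal (fun i => if colour i ∈ B then (1 : K) else 0) -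
      Matrix.diagonal (fun i => if colour i ∈ B then (1 : K) else 0) * F with hM
  have hMapply : ∀ i j, M i j =
      F i j * (if colour j ∈ B then 1 else 0) - (if colour i ∈ B then 1 else 0) * F i j := by
    intro i j
    simp only [hM, Matrix.sub_apply, Matrix.mul_diagonal, Matrix.diagonal_mul]
  have h0 : ∀ x y, ¬ (colour x ∈ B) → colour y ∉ B → M x y = 0 := by
    intro x y hx hy
    rw [hMapply, if_neg hx, if_neg hy, mul_zero, zero_mul, sub_zero]
  have key := rank_blocks_le_of_lowerLeft_zero M (fun x => colour x ∈ B) (fun y => colour y ∉ B) h0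
  have h1 : M.submatrix (Subtype.val : {x // colour x ∈ B} → σ) (Subtype.val : {y // colour y ∉ B} → σ) =
      -(F.submatrix (Subtype.val : {x // colour x ∈ B} → σ) (Subtype.val : {y // colour y ∉ B} → σ)) := by
    ext x y
    simp only [Matrix.submatrix_apply, Matrix.neg_apply, hMapply, if_pos x.2, if_neg y.2, mul_zero, one_mul,
      zero_sub]
  let e : {y // colour y ∈ B} ≃ {y // ¬ (colour y ∉ B)} := Equiv.subtypeEquivRight (fun y => by rw [not_not])
  have h2 : M.submatrix (Subtype.val : {x // ¬ (colour x ∈ B)} → σ) (Subtype.val : {y // ¬ (colour y ∉ B)} → σ) =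
      (F.submatrix (Subtype.val : {x // colour x ∉ B} → σ) (Subtype.val : {y // colour y ∈ B} → σ)).submatrix
        (Equiv.refl _) e.symm := by
    ext x y
    have hy : colour (y : σ) ∈ B := not_not.mp y.2
    simp only [Matrix.submatrix_apply, hMapply, if_neg x.2, if_pos hy, Equiv.refl_apply, mul_one, zero_mul,
      sub_zero]
    rfl
  rw [h1, rank_neg', h2, Matrix.rank_submatrix] at key
  rwa [rank_padBlock_eq colour colour F (· ∈ B) (· ∉ B), rank_padBlock_eq colour colour F (· ∉ B) (· ∈ B)]

/-- **Max-cut step.**  If every commutator `[F, D_B]` with a diagonal colour-class indicator has rank `≤ c`, then `F` is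
within rank `4c` of a colour-block-diagonal matrix (`…CutLemma.exists_blockDiagonal_of_maxCut` at a set of colours
maximising the bipartition cut, plus `cut_add_cut_le_rank_comm`). [folklore] -/
theorem exists_colourDiagonal_near [Fintype Y] (colour : σ → Y) (F : Matrix σ σ K) (c : ℕ)
    (hc : ∀ B : Finset Y, (F * Matrix.diagonal (fun i => if colour i ∈ B then (1 : K) else 0) -
      Matrix.diagonal (fun i => if colour i ∈ B then (1 : K) else 0) * F).rank ≤ c) :
    ∃ F₁ : Matrix σ σ K, (∀ i j, colour i ≠ colour j → F₁ i j = 0) ∧ (F - F₁).rank ≤ 4 * c := by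
  classical
  obtain ⟨B, -, hB⟩ := Finset.exists_max_image (univ : Finset (Finset Y))
    (fun B' => (Matrix.of fun x y => if colour x ∈ B' ∧ colour y ∉ B' then F x y else 0).rank +
      (Matrix.of fun x y => if colour x ∉ B' ∧ colour y ∈ B' then F x y else 0).rank) univ_nonempty
  obtain ⟨F₁, hsupp, hrank⟩ :=
    exists_blockDiagonal_of_maxCut colour colour F B (fun B' => hB B' (mem_univ _))
  exact ⟨F₁, hsupp,
    hrank.trans (Nat.mul_le_mul_left 4 ((cut_add_cut_le_rank_comm colour F B).trans (hc B)))⟩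

/-- `rank (F₁² − F₁) ≤ 2 · rank (F − F₁)` for an idempotent `F`: with `Δ = F − F₁`,
`F₁² − F₁ = Δ (Δ + 1 − F) − F Δ`. [folklore] -/
theorem rank_sq_sub_self_le (F F₁ : Matrix σ σ K) (hF : F * F = F) :
    (F₁ * F₁ - F₁).rank ≤ 2 * (F - F₁).rank := by
  set Δ := F - F₁ with hΔ
  have h1 : F₁ = F - Δ := by rw [hΔ, sub_sub_cancel]
  have h2 : F₁ * F₁ - F₁ = Δ * (Δ + 1 - F) - F * Δ := by
    have : (F - Δ) * (F - Δ) - (F - Δ) = Δ * (Δ + 1 - F) - F * Δ + (F * F - F) := by noncomm_ring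
    rw [h1, this, hF, sub_self, add_zero]
  rw [h2]
  calc (Δ * (Δ + 1 - F) - F * Δ).rank ≤ (Δ * (Δ + 1 - F)).rank + (F * Δ).rank := rank_sub_le' _ _
    _ ≤ Δ.rank + Δ.rank := add_le_add (Matrix.rank_mul_le_left _ _) (Matrix.rank_mul_le_right _ _)
    _ = 2 * Δ.rank := by ring

end Cuts

section Blocks

variable {Y : Type} [Fintype Y] [DecidableEq Y]

/-- **Blockwise cheap Fitting.**  On the index type `Σ y, Fin (n y)` coloured by the first coordinate: if `F` is idempotent
and `F₁` is colour-block-diagonal, then there is a colour-block-diagonal IDEMPOTENT `F'` with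
`rank (F₁ − F') ≤ rank (F₁² − F₁) ≤ 2 rank (F − F₁)` (apply `…Exactification.exists_idempotent_near` to each diagonal
block; ranks of block-diagonal matrices add, `Literature…rank_blockDiagonal'`). [folklore] -/
theorem exists_blockIdempotent_near (n : Y → ℕ)
    (F F₁ : Matrix (Σ y, Fin (n y)) (Σ y, Fin (n y)) K) (hF : F * F = F)
    (hsupp : ∀ i j, i.1 ≠ j.1 → F₁ i j = 0) :
    ∃ F' : Matrix (Σ y, Fin (n y)) (Σ y, Fin (n y)) K, F' * F' = F' ∧ (∀ i j, i.1 ≠ j.1 → F' i j = 0) ∧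
      (F₁ - F').rank ≤ 2 * (F - F₁).rank := by
  classical
  set G : ∀ y, Matrix (Fin (n y)) (Fin (n y)) K := Matrix.blockDiag' F₁ with hG
  have hF₁ : Matrix.blockDiagonal' G = F₁ := by
    ext ⟨y, i⟩ ⟨y', j⟩
    by_cases h : y = y'
    · subst h
      rw [Matrix.blockDiagonal'_apply_eq, hG, Matrix.blockDiag'_apply]
    · rw [Matrix.blockDiagonal'_apply_ne _ _ _ h, hsupp _ _ h]
  choose H hH using fun y => exists_idempotent_near (G y)
  refine ⟨Matrix.blockDiagonal' H, ?_, ?_, ?_⟩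
  · rw [← Matrix.blockDiagonal'_mul]
    exact congrArg _ (funext fun y => (hH y).1)
  · rintro ⟨y, i⟩ ⟨y', j⟩ h
    exact Matrix.blockDiagonal'_apply_ne _ _ _ h
  · have e1 : F₁ - Matrix.blockDiagonal' H = Matrix.blockDiagonal' (G - H) := by
      rw [Matrix.blockDiagonal'_sub, hF₁]
    have e2 : F₁ * F₁ - F₁ = Matrix.blockDiagonal' (fun y => G y * G y - G y) := by
      rw [← hF₁, ← Matrix.blockDiagonal'_mul, ← Matrix.blockDiagonal'_sub]
      rfl
    rw [e1, Literature.LinearAlgebra.Matrix.rank_blockDiagonal']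
    refine le_trans ?_ (rank_sq_sub_self_le F F₁ hF)
    rw [e2, Literature.LinearAlgebra.Matrix.rank_blockDiagonal']
    exact Finset.sum_le_sum fun y _ => by simpa only [Pi.sub_apply] using (hH y).2

/-- **The coordinate core.**  On `Σ y, Fin (n y)` coloured by the first coordinate, with `D_B` the diagonal indicator of a
set `B` of colours: an idempotent `F` all of whose commutators `[F, D_B]` have rank `≤ c` is within rank `12 c` of a
colour-block-diagonal idempotent (max-cut step `4c` + blockwise cheap Fitting `8c`). [folklore] -/
theorem exists_blockIdempotent_near_of_comm (n : Y → ℕ) (F : Matrix (Σ y, Fin (n y)) (Σ y, Fin (n y)) K) (c : ℕ)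
    (hF : F * F = F)
    (hc : ∀ B : Finset Y, (F * Matrix.diagonal (fun i : Σ y, Fin (n y) => if i.1 ∈ B then (1 : K) else 0) -
      Matrix.diagonal (fun i : Σ y, Fin (n y) => if i.1 ∈ B then (1 : K) else 0) * F).rank ≤ c) :
    ∃ F' : Matrix (Σ y, Fin (n y)) (Σ y, Fin (n y)) K, F' * F' = F' ∧ (∀ i j, i.1 ≠ j.1 → F' i j = 0) ∧
      (F - F').rank ≤ 12 * c := by
  obtain ⟨F₁, hsupp, h1⟩ := exists_colourDiagonal_near Sigma.fst F c hc
  obtain ⟨F', hF', hsupp', h2⟩ := exists_blockIdempotent_near n F F₁ hF hsupp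
  refine ⟨F', hF', hsupp', ?_⟩
  rw [← sub_add_sub_cancel F F₁ F']
  exact (rank_add_le' _ _).trans (by omega)

end Blocks

section Transport

variable {Y : Type} [Fintype Y] [DecidableEq Y]

/-- A colour-block-diagonal matrix on `Σ y, Fin (n y)` commutes with every diagonal matrix that is constant on the colour
classes. [folklore] -/
theorem mul_diagonal_comm_of_offBlock_zero (n : Y → ℕ) (F' : Matrix (Σ y, Fin (n y)) (Σ y, Fin (n y)) K)
    (hs : ∀ i j, i.1 ≠ j.1 → F' i j = 0) (v : Y → K) :
    F' * Matrix.diagonal (fun i => v i.1) = Matrix.diagonal (fun i => v i.1) * F' := by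
  ext i j
  rw [Matrix.mul_diagonal, Matrix.diagonal_mul]
  by_cases h : i.1 = j.1
  · rw [h, mul_comm]
  · rw [hs i j h, mul_zero, zero_mul]

omit [Fintype Y] in
/-- The diagonal indicator of a set `B` of colours is the sum of the indicators of its colour classes. [folklore] -/
theorem sum_diagonal_indicator (n : Y → ℕ) (B : Finset Y) :
    ∑ y ∈ B, Matrix.diagonal (fun i : Σ y, Fin (n y) => if i.1 = y then (1 : K) else 0) =
      Matrix.diagonal (fun i : Σ y, Fin (n y) => if i.1 ∈ B then (1 : K) else 0) := by
  ext i j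
  rw [Matrix.sum_apply]
  simp only [Matrix.diagonal_apply]
  by_cases h : i = j
  · subst h
    simp [Finset.sum_ite_eq]
  · simp [h]

omit [DecidableEq Y] in
/-- The cells `Q_y`, read as endomorphisms of `K^d`, form a complete family of orthogonal idempotents. [folklore] -/
theorem completeOrthogonalIdempotents_toLin' {d : ℕ} (Q : Y → Matrix (Fin d) (Fin d) K)
    (hQ2 : ∀ y, Q y * Q y = Q y) (hQo : ∀ y y', y ≠ y' → Q y * Q y' = 0) (hQs : ∑ y, Q y = 1) :
    CompleteOrthogonalIdempotents fun y => Matrix.toLin' (Q y) := by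
  refine ⟨⟨fun y => ?_, fun y y' h => ?_⟩, ?_⟩
  · show Matrix.toLin' (Q y) * Matrix.toLin' (Q y) = Matrix.toLin' (Q y)
    rw [Module.End.mul_eq_comp, ← Matrix.toLin'_mul, hQ2]
  · show Matrix.toLin' (Q y) * Matrix.toLin' (Q y') = 0
    rw [Module.End.mul_eq_comp, ← Matrix.toLin'_mul, hQo y y' h, map_zero]
  · show ∑ y, Matrix.toLin' (Q y) = 1
    rw [← map_sum Matrix.toLin' Q univ, hQs, Matrix.toLin'_one, Module.End.one_eq_id]

/-- **Adapted basis.**  In the collected basis of `V = ⊕ im e_y` (complete orthogonal idempotents `e_y`,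
`Literature…isInternal_range_of_completeOrthogonalIdempotents`), the matrix of `e_y` is the diagonal `0/1` indicator of
the `y`-th block. [folklore] -/
theorem toMatrix_collectedBasis_idempotent {V : Type} [AddCommGroup V] [Module K V]
    {e : Y → Module.End K V} (he : CompleteOrthogonalIdempotents e)
    (hint : DirectSum.IsInternal fun y => LinearMap.range (e y))
    {α : Y → Type} [∀ y, Fintype (α y)] [∀ y, DecidableEq (α y)]
    (v : ∀ y, Basis (α y) K (LinearMap.range (e y))) (y : Y) :
    LinearMap.toMatrix (hint.collectedBasis v) (hint.collectedBasis v) (e y) =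
      Matrix.diagonal (fun a : Σ y, α y => if a.1 = y then (1 : K) else 0) := by
  ext a a'
  rw [LinearMap.toMatrix_apply, Matrix.diagonal_apply]
  have ha' : (hint.collectedBasis v a' : V) ∈ LinearMap.range (e a'.1) := hint.collectedBasis_mem v a'
  by_cases hy : a'.1 = y
  · have hfix : e y (hint.collectedBasis v a') = hint.collectedBasis v a' := by
      obtain ⟨x, hx⟩ := LinearMap.mem_range.mp ha'
      rw [← hx, ← hy]
      show (e a'.1 * e a'.1) x = e a'.1 x
      rw [(he.idem a'.1).eq]
    rw [hfix, Basis.repr_self, Finsupp.single_apply]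
    by_cases h : a = a'
    · subst h
      rw [if_pos rfl, if_pos rfl, if_pos hy]
    · rw [if_neg (Ne.symm h), if_neg h]
  · have hzero : e y (hint.collectedBasis v a') = 0 :=
      LinearMap.mem_ker.mp (range_le_ker_of_orthogonalIdempotents he.toOrthogonalIdempotents (Ne.symm hy) ha')
    rw [hzero, map_zero, Finsupp.zero_apply]
    by_cases h : a = a'
    · subst h
      rw [if_pos rfl, if_neg hy]
    · rw [if_neg h]

/-- Matrices of an endomorphism of `K^d` in any basis have the rank of the standard matrix. [folklore] -/
theorem rank_toMatrix_toLin' {d : ℕ} {σ : Type} [Fintype σ] [DecidableEq σ] (b : Basis σ K (Fin d → K))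
    (M : Matrix (Fin d) (Fin d) K) : (LinearMap.toMatrix b b (Matrix.toLin' M)).rank = M.rank := by
  rw [Matrix.rank_eq_finrank_range_toLin (LinearMap.toMatrix b b (Matrix.toLin' M)) b b, Matrix.toLin_toMatrix]
  rfl

/-- **Transport.**  If a basis `b` of `K^d` indexed by `Σ y, Fin (n y)` diagonalises every cell `Q_y` to the indicator of
the `y`-th block, then the coordinate core `exists_blockIdempotent_near_of_comm` yields the absolute merge for the pair
`(E, Q)`: an idempotent commuting with every `Q_y` within rank `16 c` of `E`. [folklore] -/
theorem exists_commuting_idempotent_near_of_basis {d : ℕ} (n : Y → ℕ) (b : Basis (Σ y, Fin (n y)) K (Fin d → K))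
    (E : Matrix (Fin d) (Fin d) K) (Q : Y → Matrix (Fin d) (Fin d) K) (c : ℕ) (hE : E * E = E)
    (hQb : ∀ y, LinearMap.toMatrix b b (Matrix.toLin' (Q y)) =
      Matrix.diagonal (fun i : Σ y, Fin (n y) => if i.1 = y then (1 : K) else 0))
    (hc : ∀ B : Finset Y, (E * (∑ y ∈ B, Q y) - (∑ y ∈ B, Q y) * E).rank ≤ c) :
    ∃ E' : Matrix (Fin d) (Fin d) K, E' * E' = E' ∧ (∀ y, E' * Q y = Q y * E') ∧ (E - E').rank ≤ 16 * c := by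
  -- the change of coordinates `M ↦ toMatrix b b (toLin' M)` is multiplicative, additive and rank-preserving
  have hmul : ∀ M N : Matrix (Fin d) (Fin d) K, LinearMap.toMatrix b b (Matrix.toLin' (M * N)) =
      LinearMap.toMatrix b b (Matrix.toLin' M) * LinearMap.toMatrix b b (Matrix.toLin' N) := by
    intro M N
    rw [Matrix.toLin'_mul, ← Module.End.mul_eq_comp, LinearMap.toMatrix_mul]
  have hsub : ∀ M N : Matrix (Fin d) (Fin d) K, LinearMap.toMatrix b b (Matrix.toLin' (M - N)) =
      LinearMap.toMatrix b b (Matrix.toLin' M) - LinearMap.toMatrix b b (Matrix.toLin' N) := by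
    intro M N
    rw [map_sub Matrix.toLin', map_sub (LinearMap.toMatrix b b)]
  have hQB : ∀ B : Finset Y, LinearMap.toMatrix b b (Matrix.toLin' (∑ y ∈ B, Q y)) =
      Matrix.diagonal (fun i : Σ y, Fin (n y) => if i.1 ∈ B then (1 : K) else 0) := by
    intro B
    rw [map_sum Matrix.toLin', map_sum (LinearMap.toMatrix b b), ← sum_diagonal_indicator n B]
    exact Finset.sum_congr rfl fun y _ => hQb y
  obtain ⟨F, hFE⟩ : ∃ F, LinearMap.toMatrix b b (Matrix.toLin' E) = F := ⟨_, rfl⟩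
  have hF : F * F = F := by rw [← hFE, ← hmul, hE]
  have hcF : ∀ B : Finset Y,
      (F * Matrix.diagonal (fun i : Σ y, Fin (n y) => if i.1 ∈ B then (1 : K) else 0) -
        Matrix.diagonal (fun i : Σ y, Fin (n y) => if i.1 ∈ B then (1 : K) else 0) * F).rank ≤ c := by
    intro B
    rw [← hQB B, ← hFE, ← hmul, ← hmul, ← hsub, rank_toMatrix_toLin']
    exact hc B
  obtain ⟨F', hF'2, hF's, hF'r⟩ := exists_blockIdempotent_near_of_comm n F c hF hcF
  -- transport back
  obtain ⟨E', hE'⟩ : ∃ E' : Matrix (Fin d) (Fin d) K, LinearMap.toMatrix' (Matrix.toLin b b F') = E' := ⟨_, rfl⟩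
  have hΦE' : LinearMap.toMatrix b b (Matrix.toLin' E') = F' := by
    rw [← hE', Matrix.toLin'_toMatrix', LinearMap.toMatrix_toLin]
  have hinj : Function.Injective fun M : Matrix (Fin d) (Fin d) K => LinearMap.toMatrix b b (Matrix.toLin' M) :=
    (LinearMap.toMatrix b b).injective.comp Matrix.toLin'.injective
  refine ⟨E', ?_, fun y => ?_, ?_⟩
  · apply hinj
    show LinearMap.toMatrix b b (Matrix.toLin' (E' * E')) = LinearMap.toMatrix b b (Matrix.toLin' E')
    rw [hmul, hΦE', hF'2]
  · apply hinj
    show LinearMap.toMatrix b b (Matrix.toLin' (E' * Q y)) = LinearMap.toMatrix b b (Matrix.toLin' (Q y * E'))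
    rw [hmul, hmul, hΦE', hQb y]
    exact mul_diagonal_comm_of_offBlock_zero n F' hF's (fun y' => if y' = y then (1 : K) else 0)
  · rw [← rank_toMatrix_toLin' b, hsub, hΦE', hFE]
    exact hF'r.trans (by omega)

end Transport

/-- **Absolute merge for a pair** — the registered stub `stub_absoluteMergePair` of line `cell-union-merge` (crux
stmt-PneNP-18923; brief g17 §W26), the `|X| = 2` shadow of the lead stub `stub_absoluteMerge`: an idempotent `E` all of
whose commutators with the unions `Q_B = ∑_{y∈B} Q_y` of a complete system of orthogonal idempotents have rank `≤ c` is
within rank `16 c` of an idempotent commuting with every `Q_y`.  Proof: adapted (collected) basis of `K^d = ⊕ im Q_y`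
(`toMatrix_collectedBasis_idempotent`), then `exists_commuting_idempotent_near_of_basis`. [folklore] -/
theorem stub_absoluteMergePair :
    ∀ (K : Type) [Field K] (d : ℕ) (Y : Type) [Fintype Y] [DecidableEq Y]
      (E : Matrix (Fin d) (Fin d) K) (Q : Y → Matrix (Fin d) (Fin d) K) (c : ℕ),
      E * E = E →
      (∀ y, Q y * Q y = Q y) → (∀ y y', y ≠ y' → Q y * Q y' = 0) → ∑ y, Q y = 1 →
      (∀ B : Finset Y, (E * (∑ y ∈ B, Q y) - (∑ y ∈ B, Q y) * E).rank ≤ c) →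
      ∃ E' : Matrix (Fin d) (Fin d) K, E' * E' = E' ∧ (∀ y, E' * Q y = Q y * E') ∧ (E - E').rank ≤ 16 * c := by
  intro K _ d Y _ _ E Q c hE hQ2 hQo hQs hc
  have hq := completeOrthogonalIdempotents_toLin' Q hQ2 hQo hQs
  have hint : DirectSum.IsInternal fun y => LinearMap.range (Matrix.toLin' (Q y)) :=
    isInternal_range_of_completeOrthogonalIdempotents hq
  exact exists_commuting_idempotent_near_of_basis
    (fun y => finrank K (LinearMap.range (Matrix.toLin' (Q y))))
    (hint.collectedBasis fun y => Module.finBasis K _) E Q c hE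
    (fun y => toMatrix_collectedBasis_idempotent hq hint _ y) hc

end Summit.PneNP.PneNP.Theorems.CnfIdealGenLengthRankDefectRepresentationsAbsoluteMergePair
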